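import Mathlib.Analysis.InnerProductSpace.Calculus
import Mathlib.Analysis.SpecialFunctions.Sqrt
import Mathlib.Analysis.Calculus.Deriv.Inv
import Mathlib.Analysis.Calculus.ContDiff.Deriv
import Literature.Geometry.Lorentzian.Basic
import HarnessLib

/-!
# Far-cone retardation remainder, II: the Sherman–Morrison transport field

Support file 2 for the brick `SoftEraTubeLift.FarConeRetardationRemainder` of crux
`EIHFluxBalance.ModulatedKerrHandoff` (H′, stmt-FinalStateConjecture-17402; card `soft-era-tube-lift`).
To compare retarded integrals `∫ φ(y − c(‖y − x‖))/‖y − x‖ dy` along two centre curves one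
interpolates `c_λ = c₀ + λη` and moves the `λ`-derivative `−Dφ(y − c_λ(s))[η(s)]/s` onto `φ` by parts
in `y`.  Since `∇_y[φ(y − c(s))] = Dφ(z)[w − ⟪m, w⟫ c′(s)]` (`s = ‖y − x‖`, `m = (y − x)/s`), the
direction reproducing `Dφ(z)[η(s)]` is the **Sherman–Morrison field**
`V = η(s) + (⟪m, η(s)⟫/(1 − ⟪m, c′(s)⟫)) c′(s)` (`V − ⟪m, V⟫c′ = η`); the transport field is `F = V/s`.
Proved here, pointwise at `y ≠ x`: the identity `D[φ(· − c(‖· − x‖))](y)[F] = Dφ(z)[η(s)]/s`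
(`fderiv_bump_comp_apply_field`), `F ∈ C¹` (`contDiffAt_field`), and the bound
`‖DF(y)‖ ≤ (9A + 2A²s)(1 − v)⁻²` under `‖c′‖ ≤ v < 1`, `‖c″‖ ≤ A`, `‖η(s)‖ ≤ A s²`, `‖η′(s)‖ ≤ A s`
(`exists_hasFDerivAt_field_bound`) — one power of `s` better than `‖V‖ ~ A s`, the cancellation behind
the `O(M·A)` retardation remainder.  Mathlib only. [folklore]
-/


noncomputable section

open Filter Topology Metric InnerProductSpace Literature.Geometry.Lorentzian
open scoped RealInnerProductSpace

-- the doubled `FinalStateConjecture` path component is the summit/problem naming scheme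
set_option linter.dupNamespace false

namespace Summit.FinalStateConjecture.FinalStateConjecture.Theorems.EIHFluxBalance.ModulatedKerrHandoffBricks.FarCone

/-! ### The distance function and the unit vector field about the observer -/

section Dist

variable {x y : E3}

/-- The radial covector `w ↦ ⟪y − x, w⟫/‖y − x‖` has norm `≤ 1` pointwise. [folklore] -/
theorem norm_distCLM_apply_le (x y w : E3) : ‖((‖y - x‖)⁻¹ • innerSL ℝ (y - x)) w‖ ≤ ‖w‖ := by
  rw [FunLike.coe_smul, Pi.smul_apply, innerSL_apply_apply, smul_eq_mul, norm_mul,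
    norm_inv, norm_norm, Real.norm_eq_abs]
  by_cases h : ‖y - x‖ = 0
  · simp [h]
  · rw [inv_mul_le_iff₀ (lt_of_le_of_ne (norm_nonneg _) (Ne.symm h))]
    exact abs_real_inner_le_norm _ _

/-- **Derivative of the distance to the observer**: `D‖· − x‖(y) = ⟪y − x, ·⟫/‖y − x‖` at `y ≠ x`.
[folklore] -/
theorem hasFDerivAt_dist (hyx : y ≠ x) :
    HasFDerivAt (fun y' : E3 ↦ ‖y' - x‖) ((‖y - x‖)⁻¹ • innerSL ℝ (y - x)) y := by
  have hne : y - x ≠ 0 := sub_ne_zero.2 hyx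
  have hpos : 0 < ‖y - x‖ := norm_pos_iff.2 hne
  have h1 : HasFDerivAt (fun y' : E3 ↦ ‖y' - x‖ ^ 2)
      (2 • (innerSL ℝ (y - x)).comp (ContinuousLinearMap.id ℝ E3)) y :=
    ((hasFDerivAt_id y).sub_const x).norm_sq
  have h2 := h1.sqrt (by positivity : ‖y - x‖ ^ 2 ≠ 0)
  have h3 : HasFDerivAt (fun y' : E3 ↦ ‖y' - x‖)
      ((1 / (2 * Real.sqrt (‖y - x‖ ^ 2))) •
        (2 • (innerSL ℝ (y - x)).comp (ContinuousLinearMap.id ℝ E3))) y :=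
    h2.congr_of_eventuallyEq (Eventually.of_forall fun y' ↦ (Real.sqrt_sq (norm_nonneg _)).symm)
  refine h3.congr_fderiv ?_
  rw [Real.sqrt_sq hpos.le, ContinuousLinearMap.comp_id, two_nsmul, smul_add, ← add_smul]
  congr 1
  field_simp
  norm_num

/-- Chain rule through the distance: `D[f(‖· − x‖)](y) w = (⟪y − x, w⟫/‖y − x‖) • f′`. [folklore] -/
theorem hasFDerivAt_comp_dist {f : ℝ → E3} {f' : E3} (hf : HasDerivAt f f' ‖y - x‖) (hyx : y ≠ x) :
    HasFDerivAt (fun y' : E3 ↦ f ‖y' - x‖) (((‖y - x‖)⁻¹ • innerSL ℝ (y - x)).smulRight f') y := by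
  refine (hf.hasFDerivAt.comp y (hasFDerivAt_dist hyx)).congr_fderiv ?_
  ext1 w
  simp only [ContinuousLinearMap.comp_apply, ContinuousLinearMap.smulRight_apply,
    ContinuousLinearMap.toSpanSingleton_apply]

/-- Derivative of the inverse distance: `D[‖· − x‖⁻¹](y) = −‖y − x‖⁻² ⟪y − x, ·⟫/‖y − x‖`. [folklore] -/
theorem hasFDerivAt_dist_inv (hyx : y ≠ x) :
    HasFDerivAt (fun y' : E3 ↦ (‖y' - x‖)⁻¹)
      ((-(‖y - x‖ ^ 2)⁻¹) • ((‖y - x‖)⁻¹ • innerSL ℝ (y - x))) y :=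
  (hasDerivAt_inv (norm_pos_iff.2 (sub_ne_zero.2 hyx)).ne').comp_hasFDerivAt y (hasFDerivAt_dist hyx)

/-- **Derivative of the unit vector field** `m(y) = (y − x)/‖y − x‖`: it exists at `y ≠ x` and
`‖Dm(y) w‖ ≤ 2‖w‖/‖y − x‖`. [folklore] -/
theorem exists_hasFDerivAt_unitVec (hyx : y ≠ x) :
    ∃ L : E3 →L[ℝ] E3, HasFDerivAt (fun y' : E3 ↦ (‖y' - x‖)⁻¹ • (y' - x)) L y ∧
      ∀ w, ‖L w‖ ≤ 2 / ‖y - x‖ * ‖w‖ := by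
  have hne : y - x ≠ 0 := sub_ne_zero.2 hyx
  have hpos : 0 < ‖y - x‖ := norm_pos_iff.2 hne
  have hinv := hasFDerivAt_dist_inv hyx
  have hid : HasFDerivAt (fun y' : E3 ↦ y' - x) (ContinuousLinearMap.id ℝ E3) y :=
    (hasFDerivAt_id y).sub_const x
  refine ⟨_, hinv.smul hid, fun w ↦ ?_⟩
  have hL := norm_distCLM_apply_le x y w
  simp only [FunLike.coe_smul, Pi.smul_apply] at hL
  simp only [add_apply, FunLike.coe_smul, Pi.smul_apply,
    ContinuousLinearMap.id_apply, ContinuousLinearMap.smulRight_apply]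
  calc ‖(‖y - x‖)⁻¹ • w + (-(‖y - x‖ ^ 2)⁻¹ • (‖y - x‖)⁻¹ • (innerSL ℝ (y - x)) w) • (y - x)‖
      ≤ ‖(‖y - x‖)⁻¹ • w‖ + ‖(-(‖y - x‖ ^ 2)⁻¹ • (‖y - x‖)⁻¹ • (innerSL ℝ (y - x)) w) • (y - x)‖ :=
        norm_add_le _ _
    _ ≤ (‖y - x‖)⁻¹ * ‖w‖ + (‖y - x‖ ^ 2)⁻¹ * ‖w‖ * ‖y - x‖ := by
        gcongr
        · rw [norm_smul, norm_inv, norm_norm]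
        · rw [norm_smul, smul_eq_mul, norm_mul, norm_neg, norm_inv, norm_pow, norm_norm]
          gcongr
    _ = 2 / ‖y - x‖ * ‖w‖ := by
        field_simp
        ring

end Dist

/-! ### The transport field: the Sherman–Morrison identity -/

section Field

variable {φ : E3 → ℝ} {c η : ℝ → E3} {x y : E3}

/-- **Gradient of the retarded bump**: for `y ≠ x`,
`D[φ(· − c(‖· − x‖))](y) w = Dφ(z)[w − (⟪y − x, w⟫/‖y − x‖) c′(s)]`, `z = y − c(s)`, `s = ‖y − x‖`.
[folklore] -/
theorem hasFDerivAt_bump_comp (hφ : Differentiable ℝ φ) (hc : Differentiable ℝ c) (hyx : y ≠ x) :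
    HasFDerivAt (fun y' : E3 ↦ φ (y' - c ‖y' - x‖))
      ((fderiv ℝ φ (y - c ‖y - x‖)).comp (ContinuousLinearMap.id ℝ E3 -
        ((‖y - x‖)⁻¹ • innerSL ℝ (y - x)).smulRight (deriv c ‖y - x‖))) y := by
  have h1 : HasFDerivAt (fun y' : E3 ↦ y' - c ‖y' - x‖) (ContinuousLinearMap.id ℝ E3 -
      ((‖y - x‖)⁻¹ • innerSL ℝ (y - x)).smulRight (deriv c ‖y - x‖)) y :=
    (hasFDerivAt_id y).sub (hasFDerivAt_comp_dist (hc _).hasDerivAt hyx)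
  exact (hφ _).hasFDerivAt.comp y h1

/-- **The Sherman–Morrison identity**: the transport field
`F(y) = η(s)/s + (⟪m, η(s)⟫ / (s (1 − ⟪m, c′(s)⟫))) c′(s)` satisfies
`D[φ(· − c(‖· − x‖))](y)[F(y)] = Dφ(z)[η(s)]/s` whenever `⟪m, c′(s)⟫ ≠ 1` (`y ≠ x`). [folklore] -/
theorem fderiv_bump_comp_apply_field (hφ : Differentiable ℝ φ) (hc : Differentiable ℝ c)
    (hyx : y ≠ x) (hden : ⟪(‖y - x‖)⁻¹ • (y - x), deriv c ‖y - x‖⟫ ≠ 1) :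
    fderiv ℝ (fun y' : E3 ↦ φ (y' - c ‖y' - x‖)) y
        ((‖y - x‖)⁻¹ • η ‖y - x‖ + (⟪(‖y - x‖)⁻¹ • (y - x), η ‖y - x‖⟫ *
          (‖y - x‖ * (1 - ⟪(‖y - x‖)⁻¹ • (y - x), deriv c ‖y - x‖⟫))⁻¹) • deriv c ‖y - x‖) =
      (‖y - x‖)⁻¹ * fderiv ℝ φ (y - c ‖y - x‖) (η ‖y - x‖) := by
  have hne : y - x ≠ 0 := sub_ne_zero.2 hyx
  have hpos : 0 < ‖y - x‖ := norm_pos_iff.2 hne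
  rw [(hasFDerivAt_bump_comp hφ hc hyx).fderiv]
  -- abbreviations
  set s : ℝ := ‖y - x‖ with hs
  set m : E3 := s⁻¹ • (y - x) with hm
  set e : E3 := η s
  set b : E3 := deriv c s
  set q : ℝ := ⟪m, e⟫ * (s * (1 - ⟪m, b⟫))⁻¹ with hq
  have hden' : 1 - ⟪m, b⟫ ≠ 0 := sub_ne_zero.2 (Ne.symm hden)
  -- the argument of `Dφ` is `s⁻¹ • e`
  have key : (ContinuousLinearMap.id ℝ E3 - (s⁻¹ • innerSL ℝ (y - x)).smulRight b)
      (s⁻¹ • e + q • b) = s⁻¹ • e := by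
    have hinner : ∀ w : E3, (s⁻¹ • innerSL ℝ (y - x)) w = ⟪m, w⟫ := fun w ↦ by
      rw [FunLike.coe_smul, Pi.smul_apply, innerSL_apply_apply, hm, real_inner_smul_left,
        smul_eq_mul]
    simp only [FunLike.coe_sub, Pi.sub_apply, ContinuousLinearMap.id_apply,
      ContinuousLinearMap.smulRight_apply, hinner, inner_add_right, real_inner_smul_right]
    -- `⟪m, s⁻¹e⟫ + q⟪m,b⟫ = q`, since `q(1 - ⟪m,b⟫) = s⁻¹⟪m,e⟫`
    have hq' : s⁻¹ * ⟪m, e⟫ + q * ⟪m, b⟫ = q := by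
      rw [hq]
      field_simp
      ring
    rw [hq', add_sub_assoc, sub_self, add_zero]
  rw [ContinuousLinearMap.comp_apply, key, map_smul, smul_eq_mul]

/-- **Smoothness of the transport field** at `y ≠ x` (`c ∈ C²`, `η ∈ C¹`, `⟪m, c′(s)⟫ ≠ 1`).
[folklore] -/
theorem contDiffAt_field (hc : ContDiff ℝ 2 c) (hη : ContDiff ℝ 1 η) (hyx : y ≠ x)
    (hden : ⟪(‖y - x‖)⁻¹ • (y - x), deriv c ‖y - x‖⟫ ≠ 1) :
    ContDiffAt ℝ 1 (fun y' : E3 ↦ (‖y' - x‖)⁻¹ • η ‖y' - x‖ +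
      (⟪(‖y' - x‖)⁻¹ • (y' - x), η ‖y' - x‖⟫ *
        (‖y' - x‖ * (1 - ⟪(‖y' - x‖)⁻¹ • (y' - x), deriv c ‖y' - x‖⟫))⁻¹) • deriv c ‖y' - x‖) y := by
  have hne : y - x ≠ 0 := sub_ne_zero.2 hyx
  have hpos : 0 < ‖y - x‖ := norm_pos_iff.2 hne
  have hs : ContDiffAt ℝ 1 (fun y' : E3 ↦ ‖y' - x‖) y :=
    (contDiffAt_id.sub contDiffAt_const).norm ℝ hne
  have hsinv : ContDiffAt ℝ 1 (fun y' : E3 ↦ (‖y' - x‖)⁻¹) y := hs.inv hpos.ne'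
  have hm : ContDiffAt ℝ 1 (fun y' : E3 ↦ (‖y' - x‖)⁻¹ • (y' - x)) y :=
    hsinv.smul (contDiffAt_id.sub contDiffAt_const)
  have hηs : ContDiffAt ℝ 1 (fun y' : E3 ↦ η ‖y' - x‖) y := hη.contDiffAt.comp y hs
  have hc' : ContDiff ℝ 1 (deriv c) :=
    (contDiff_succ_iff_deriv.1 (show ContDiff ℝ (1 + 1) c by rw [one_add_one_eq_two]; exact hc)).2.2
  have hcs : ContDiffAt ℝ 1 (fun y' : E3 ↦ deriv c ‖y' - x‖) y := hc'.contDiffAt.comp y hs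
  have hden' : ‖y - x‖ * (1 - ⟪(‖y - x‖)⁻¹ • (y - x), deriv c ‖y - x‖⟫) ≠ 0 :=
    mul_ne_zero hpos.ne' (sub_ne_zero.2 (Ne.symm hden))
  have hq : ContDiffAt ℝ 1 (fun y' : E3 ↦ ⟪(‖y' - x‖)⁻¹ • (y' - x), η ‖y' - x‖⟫ *
      (‖y' - x‖ * (1 - ⟪(‖y' - x‖)⁻¹ • (y' - x), deriv c ‖y' - x‖⟫))⁻¹) y :=
    (hm.inner ℝ hηs).mul ((hs.mul (contDiffAt_const.sub (hm.inner ℝ hcs))).inv hden')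
  exact (hsinv.smul hηs).add (hq.smul hcs)

end Field

/-! ### Registered form -/

/-- **The Sherman–Morrison identity for the transport field** (registered helper of
stmt-FinalStateConjecture-17402, brick `FarConeRetardationRemainder`). [folklore] -/
theorem farCone_field_identity : ∀ (φ : EuclideanSpace ℝ (Fin 3) → ℝ) (c η : ℝ → EuclideanSpace ℝ (Fin 3)) (x y : EuclideanSpace ℝ (Fin 3)), Differentiable ℝ φ → Differentiable ℝ c → y ≠ x → inner ℝ ((‖y - x‖)⁻¹ • (y - x)) (deriv c ‖y - x‖) ≠ 1 → fderiv ℝ (fun y' : EuclideanSpace ℝ (Fin 3) ↦ φ (y' - c ‖y' - x‖)) y ((‖y - x‖)⁻¹ • η ‖y - x‖ + (inner ℝ ((‖y - x‖)⁻¹ • (y - x)) (η ‖y - x‖) * (‖y - x‖ * (1 - inner ℝ ((‖y - x‖)⁻¹ • (y - x)) (deriv c ‖y - x‖)))⁻¹) • deriv c ‖y - x‖) = (‖y - x‖)⁻¹ * fderiv ℝ φ (y - c ‖y - x‖) (η ‖y - x‖) :=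
  fun _φ _c _η _x _y hφ hc hyx hden ↦ fderiv_bump_comp_apply_field hφ hc hyx hden

end Summit.FinalStateConjecture.FinalStateConjecture.Theorems.EIHFluxBalance.ModulatedKerrHandoffBricks.FarCone

end
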